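import Summits.ABC.ABC.Theses.IneffectiveSubspace

/-!
# Sketch (ideator 2, round 1) — crux stmt-ABC-14938 `DepthCountedABC`

First lemmas of the idea card `shallow-cell-shadow-atlas` (crux-ideate, route-ABC-IneffectiveSubspace).
Everything here is a STATEMENT (`def … : Prop`) except the normal-form lemma `cruxNormalForm` and the
composition `crux_of_base_step`, which are proved.  Namespace per the crux convention.

Dictionary.  ω₅(n) = #{p : p⁵ ∣ n};  Cell_K(A) = "abc with exponent A and a constant C(K,A) on the
triples with ω₅(abc) ≤ K";  the crux is `∀ K, ∀ A > 1, Cell_K(A)` (`cruxNormalForm`).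
-/

set_option linter.dupNamespace false

namespace Summit.ABC.ABC.Cruxes.DepthCountedABC.Ideator2

open scoped BigOperators
open Literature.NumberTheory.DiophantineGeometry (IsABCTriple rad)
open Summit.ABC.ABC.Theses.IneffectiveSubspace

/-- The 5-depth count `ω₅(n) = #{p prime : p⁵ ∣ n}` — verbatim the filter/card of the crux. -/
def omega5 (n : ℕ) : ℕ := (n.primeFactors.filter (fun p => 5 ≤ n.factorization p)).card

/-- `n` is 5-free (every prime exponent is ≤ 4). -/
def FiveFree (n : ℕ) : Prop := ∀ p ∈ n.primeFactors, n.factorization p ≤ 4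

/-- Cell `K` of the crux at exponent `A`: abc with exponent `A` (= 1+ε) and ONE constant on the triples
with at most `K` primes at depth ≥ 5. -/
def CellABC (K : ℕ) (A : ℝ) : Prop :=
  ∃ C : ℝ, 0 < C ∧ ∀ a b c : ℕ, IsABCTriple a b c → omega5 (a * b * c) ≤ K →
    (c : ℝ) < C * ((rad a b c : ℕ) : ℝ) ^ A

/-- NORMAL FORM (proved): the crux is the conjunction of all cells at all exponents `A > 1`. -/
theorem cruxNormalForm : DepthCountedABC ↔ ∀ K : ℕ, ∀ A : ℝ, 1 < A → CellABC K A := by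
  constructor
  · intro h K A hA
    obtain ⟨C, hC, hh⟩ := h K (A - 1) (by linarith)
    refine ⟨C, hC, fun a b c ht hK => ?_⟩
    have := hh a b c ht hK
    rwa [show (1 : ℝ) + (A - 1) = A by ring] at this
  · intro h K ε hε
    obtain ⟨C, hC, hh⟩ := h K (1 + ε) (by linarith)
    exact ⟨C, hC, fun a b c ht hK => hh a b c ht hK⟩

/-! ## The line: BASE (the 5-free cell) + STEP (one more deep prime costs a constant) -/

/-- BASE = cell 0 = abc for 5-free triples (all exponents of `abc` at most 4), every exponent `A > 1`. -/
def Base : Prop := ∀ A : ℝ, 1 < A → CellABC 0 A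

/-- STEP = the depth increment: cell `K` at every exponent gives cell `K+1` at every exponent. -/
def Step : Prop := ∀ K : ℕ, (∀ A : ℝ, 1 < A → CellABC K A) → (∀ A : ℝ, 1 < A → CellABC (K + 1) A)

/-- Composition (proved): BASE and STEP give the crux BY NAME, by induction on `K`. -/
theorem crux_of_base_step (hb : Base) (hs : Step) : DepthCountedABC := by
  rw [cruxNormalForm]
  intro K
  induction K with
  | zero => exact hb
  | succ K ih => exact hs K ih

/-! ## Calibration (all provable now, elementary): where "nothing" sits in each cell -/

/-- m-free abc is TRIVIAL for `m ≤ 3`: a cube-free triple has `c² ≤ 2·abc… ≤ 2·rad(abc)²`, i.e. exponent 1,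
constant √2 (so the route's "cube-free abc via the squaring identity" remark is vacuous). -/
def CubeFreeTrivial : Prop :=
  ∀ a b c : ℕ, IsABCTriple a b c → (∀ p ∈ (a * b * c).primeFactors, (a * b * c).factorization p ≤ 2) →
    c ^ 2 ≤ 2 * (rad a b c) ^ 2

/-- Cell 0 at exponent 2 is free: a 5-free triple has `abc ≤ rad⁴` and `abc ≥ c²/2`, so `c² ≤ 2·rad⁴`. -/
def CalibrationZero : Prop :=
  ∀ a b c : ℕ, IsABCTriple a b c → FiveFree (a * b * c) → c ^ 2 ≤ 2 * (rad a b c) ^ 4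

/-- Cell 1 at exponent 4 is free: with one deep prime, two of `a, b, c` are 5-free, whence `c ≤ 2·rad⁴`.
(From `K = 2` on NO unconditional exponent is known to this seat: shape `(p^e, b, q^f)`, `b` 5-free,
regime `p ≈ q ≈ exp(√log c)` where neither two-log Baker nor `pq ∣ rad` bites.) -/
def CalibrationOne : Prop :=
  ∀ a b c : ℕ, IsABCTriple a b c → omega5 (a * b * c) ≤ 1 → c ≤ 2 * (rad a b c) ^ 4

/-! ## Necessity shadows of the 5-free cell (all provable now, elementary exponent bookkeeping).
Thresholds `ij/(i+j)`: below exponent 2 the cell contains the uniform binomial QUARTIC saving (crux #4's core),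
below 12/7 a (4,3)-Hall power saving, below 3/2 the uniform binomial CUBIC Thue bound UPBT(3), below 4/3 the
sharp uniform Mordell bound for Fermat-quartic twists, below 6/5 squarefree HALL with exponent `3/A − 5/2`
(= `1/2 − O(ε)` at `A = 1+ε`).  `FiveFree (a*b*c)` encodes all side conditions (squarefree variables etc.). -/

/-- Squarefree-Hall shadow at exponent `θ`: `|x³ − y²| ≥ C·x^θ` on the 5-free configurations. -/
def HallShadow (θ : ℝ) : Prop :=
  ∃ C : ℝ, 0 < C ∧ ∀ x y : ℕ, 0 < x → 0 < y → Nat.Coprime x y → x ^ 3 ≠ y ^ 2 →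
    FiveFree (x ^ 3 * y ^ 2 * Int.natAbs ((x : ℤ) ^ 3 - (y : ℤ) ^ 2)) →
      C * (x : ℝ) ^ θ ≤ |(x : ℝ) ^ 3 - (y : ℝ) ^ 2|

/-- SHADOW 1 (A < 6/5): cell 0 at exponent `A` implies squarefree Hall with exponent `3/A − 5/2`
(triple `(y², k, x³)` or `(x³, k, y²)`, `rad ≤ k·y·x ≤ k·x^{5/2}`). At `A → 1⁺` this is Hall's `1/2 − ε`
(`Literature.NumberTheory.DiophantineGeometry.HallConjecture` restricted to 5-free configurations), for which no
power saving `θ > 0` whatsoever is known (Elkies 2000 §4.1, quoted in `Literature.Barriers.ABC.HallExponentSharp`). -/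
def ShadowHall : Prop := ∀ A : ℝ, 1 < A → A < 6 / 5 → CellABC 0 A → HallShadow (3 / A - 5 / 2)

/-- SHADOW 2 (A < 12/7): a (4,3)-Hall power saving `|x⁴ − y³| ≥ C·x^{4/A − 7/3}` on 5-free configurations. -/
def ShadowQuarticCubic : Prop :=
  ∀ A : ℝ, 1 < A → A < 12 / 7 → CellABC 0 A → ∃ C : ℝ, 0 < C ∧ ∀ x y : ℕ, 0 < x → 0 < y →
    Nat.Coprime x y → x ^ 4 ≠ y ^ 3 → FiveFree (x ^ 4 * y ^ 3 * Int.natAbs ((x : ℤ) ^ 4 - (y : ℤ) ^ 3)) →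
      C * (x : ℝ) ^ (4 / A - 7 / 3) ≤ |(x : ℝ) ^ 4 - (y : ℝ) ^ 3|

/-- SHADOW 3 (A < 3/2): the uniform polynomial bound for binomial CUBIC Thue equations `w Z³ − v Y³ = a`
(card rounded-radical-thue-ladder's UPBT(3)), on 5-free configurations, with exponent `A/(3 − 2A)`. -/
def ShadowCubicThue : Prop :=
  ∀ A : ℝ, 1 < A → A < 3 / 2 → CellABC 0 A → ∃ C : ℝ, 0 < C ∧ ∀ a v w Y Z : ℕ,
    IsABCTriple a (v * Y ^ 3) (w * Z ^ 3) → FiveFree (a * (v * Y ^ 3) * (w * Z ^ 3)) →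
      (Z : ℝ) ≤ C * ((a : ℝ) * ((UniqueFactorizationMonoid.radical (v * w) : ℕ) : ℝ)) ^ (A / (3 - 2 * A))

/-- SHADOW 4 (A < 4/3): sharp uniform Mordell for the Fermat-quartic twists `uX⁴ + vY⁴ = wZ⁴`, measured against
the radical of the COEFFICIENTS (the closed route FermatTwistHeights' `TwistHeightBound` at p = 4, restricted to
5-free points): `Z ≤ C·rad(uvw)^{A/(4−3A)}` — exponent `→ 1` as `A → 1`. -/
def ShadowQuarticTwist : Prop :=
  ∀ A : ℝ, 1 < A → A < 4 / 3 → CellABC 0 A → ∃ C : ℝ, 0 < C ∧ ∀ u v w X Y Z : ℕ,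
    IsABCTriple (u * X ^ 4) (v * Y ^ 4) (w * Z ^ 4) → FiveFree (u * X ^ 4 * (v * Y ^ 4) * (w * Z ^ 4)) →
      (Z : ℝ) ≤ C * ((UniqueFactorizationMonoid.radical (u * v * w) : ℕ) : ℝ) ^ (A / (4 - 3 * A))

/-- SHADOW 4b (A < 4/3): the lopsided (4,2) configuration WITH coefficients, `k + vY² = wZ⁴` (Ljunggren-type: rational
approximations `Y/Z²` to `√(w/v)` with SQUARE denominators; census: `1 + 239² = 2·13⁴`, quality 1.254, is the 4th 5-free triple up to
3·10⁸).  Pure `x⁴ − y²` factors and never bites; with a non-square coefficient ratio it bites below 4/3: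
`Z ≤ C·(k·rad(vw))^{A/(4−3A)}`. -/
def ShadowQuarticQuadratic : Prop :=
  ∀ A : ℝ, 1 < A → A < 4 / 3 → CellABC 0 A → ∃ C : ℝ, 0 < C ∧ ∀ k v w Y Z : ℕ,
    IsABCTriple k (v * Y ^ 2) (w * Z ^ 4) → FiveFree (k * (v * Y ^ 2) * (w * Z ^ 4)) →
      (Z : ℝ) ≤ C * ((k : ℝ) * ((UniqueFactorizationMonoid.radical (v * w) : ℕ) : ℝ)) ^ (A / (4 - 3 * A))

/-- SHADOW 5 (A < 2): the uniform binomial QUARTIC saving — crux #4's core (cf. the landed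
`Summit.ABC.ABC.Theorems.TowerFourSubLiouville.stub_coreIffCrux`) — restricted to 5-free configurations. -/
def ShadowQuarticBinomial : Prop :=
  ∀ A : ℝ, 1 < A → A < 2 → CellABC 0 A → ∃ η : ℝ, 0 < η ∧ ∃ Z₀ : ℕ, ∀ v w Y Z : ℕ, Z₀ ≤ Z →
    0 < v → 0 < w → 0 < Y → Nat.Coprime (v * Y) (w * Z) →
      FiveFree (v * Y ^ 4 * (w * Z ^ 4) * Int.natAbs ((w * Z ^ 4 : ℕ) - (v * Y ^ 4 : ℕ) : ℤ)) →
        ((max v w : ℕ) : ℝ) ≤ (Z : ℝ) ^ η → w * Z ^ 4 ≠ v * Y ^ 4 →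
          (Z : ℝ) ^ η < |((w * Z ^ 4 : ℕ) : ℝ) - ((v * Y ^ 4 : ℕ) : ℝ)|

/-! ## Reduced-tower normal form (both directions provable now): the crux IS crux #2 on reduced points -/

/-- `UniformSadicTowerFour` restricted to REDUCED points — those whose S-free part of `∏ xᵢyᵢzᵢ` is squarefree
(equivalently: the S-free parts of the twelve coordinates are squarefree and pairwise coprime).  These are exactly
the optimal lifts of Cell_K triples with `S :=` the deep primes. -/
def ReducedUSTF : Prop :=
  ∀ K : ℕ, ∀ ε : ℝ, 0 < ε → ∃ C : ℝ, 0 < C ∧ ∀ S : Finset ℕ, S.card ≤ K → (∀ p ∈ S, Nat.Prime p) →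
    ∀ x y z : Fin 4 → ℕ, (∀ i, 0 < x i ∧ 0 < y i ∧ 0 < z i) →
      (∀ p ∉ S, (∏ i, x i * y i * z i).factorization p ≤ 1) →
      (∏ i, x i ^ (i.val + 1)) + (∏ i, y i ^ (i.val + 1)) = ∏ i, z i ^ (i.val + 1) →
      Nat.Coprime (∏ i, x i ^ (i.val + 1)) (∏ i, y i ^ (i.val + 1)) →
        ((∏ i, z i ^ (i.val + 1) : ℕ) : ℝ) <
          C * (((∏ p ∈ S, p) * ∏ p ∈ (∏ i, x i * y i * z i).primeFactors \ S,
            p ^ (∏ i, x i * y i * z i).factorization p : ℕ) : ℝ) ^ (1 + ε)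

/-- The crux is EQUIVALENT to crux #2 (`UniformSadicTowerFour`) restricted to reduced points: `→` by reading a
reduced point as a Cell_K triple (deep primes ⊆ S, `rad(abc) ≤ (∏_S p)·{∏xyz}^S`), `←` by optimal lifts with
`S :=` the deep primes (the route's support `TowerFourGivesDepthCounted` verbatim).  So cruxes #2 and #5 differ
exactly by reducedness of the tower point, and every engine verdict for #2 (NoGo at `S = ∞`) is inherited. -/
def ReducedTowerIff : Prop := DepthCountedABC ↔ ReducedUSTF

/-- Crux #2 as filed trivially gives the reduced form (drop the reducedness hypothesis). -/
theorem reducedUSTF_of_ustf (h : UniformSadicTowerFour) : ReducedUSTF := by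
  intro K ε hε
  obtain ⟨C, hC, hh⟩ := h K ε hε
  exact ⟨C, hC, fun S hS hP x y z hpos _ hsum hcop => hh S hS hP x y z hpos hsum hcop⟩

/-! ## Proofs of the three calibrations (kernel-checked, rc 0): the line's first lemmas ARE landed here -/

section CalibrationProofs
open UniqueFactorizationMonoid (radical)

/-- If every prime exponent of `n ≠ 0` is at most `m`, then `n ≤ rad(n)^m`. -/
theorem le_radical_pow_of_factorization_le {n m : ℕ} (hn : n ≠ 0)
    (h : ∀ p ∈ n.primeFactors, n.factorization p ≤ m) : n ≤ (radical n) ^ m := by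
  have hself : ∏ p ∈ n.primeFactors, p ^ n.factorization p = n := by
    conv_rhs => rw [← Nat.prod_factorization_pow_eq_self hn]
    rw [Finsupp.prod, Nat.support_factorization]
  calc n = ∏ p ∈ n.primeFactors, p ^ n.factorization p := hself.symm
    _ ≤ ∏ p ∈ n.primeFactors, p ^ m := by
        apply Finset.prod_le_prod'
        intro p hp
        exact Nat.pow_le_pow_right (Nat.pos_of_mem_primeFactors hp) (h p hp)
    _ = (∏ p ∈ n.primeFactors, p) ^ m := (Finset.prod_pow _ _ _)
    _ = (radical n) ^ m := by rw [Nat.radical_eq_prod_primeFactors]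

/-- `c² ≤ 2·abc` for an abc triple (`a, b ≥ 1`, `c = a + b`). -/
theorem sq_le_two_mul_prod {a b c : ℕ} (h : IsABCTriple a b c) : c ^ 2 ≤ 2 * (a * b * c) := by
  obtain ⟨ha, hb, hsum, -⟩ := h
  subst hsum
  obtain ⟨a', rfl⟩ : ∃ a', a = a' + 1 := ⟨a - 1, by omega⟩
  obtain ⟨b', rfl⟩ : ∃ b', b = b' + 1 := ⟨b - 1, by omega⟩
  have key : (a' + 1) + (b' + 1) ≤ 2 * ((a' + 1) * (b' + 1)) := by nlinarith [Nat.zero_le (a' * b')]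
  calc ((a' + 1) + (b' + 1)) ^ 2 = ((a' + 1) + (b' + 1)) * ((a' + 1) + (b' + 1)) := by ring
    _ ≤ (2 * ((a' + 1) * (b' + 1))) * ((a' + 1) + (b' + 1)) := Nat.mul_le_mul_right _ key
    _ = 2 * ((a' + 1) * (b' + 1) * ((a' + 1) + (b' + 1))) := by ring

/-- Radical of a factor is at most the radical of the product (in `ℕ`). -/
theorem radical_le_radical_of_dvd {x y : ℕ} (hy : y ≠ 0) (h : x ∣ y) : radical x ≤ radical y :=
  Nat.le_of_dvd (Nat.radical_pos y) (UniqueFactorizationMonoid.radical_dvd_radical h hy)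

/-- A shallow (5-free) factor of `n` is at most `rad(n)⁴`. -/
theorem le_radical_pow_four_of_dvd {x n : ℕ} (hn : n ≠ 0) (hdvd : x ∣ n)
    (hx : ∀ p ∈ x.primeFactors, x.factorization p ≤ 4) : x ≤ (radical n) ^ 4 := by
  have hx0 : x ≠ 0 := by rintro rfl; exact hn (zero_dvd_iff.mp hdvd)
  calc x ≤ (radical x) ^ 4 := le_radical_pow_of_factorization_le hx0 hx
    _ ≤ (radical n) ^ 4 := Nat.pow_le_pow_left (radical_le_radical_of_dvd hn hdvd) 4

/-- If a factor `x ∣ n` has a prime at depth ≥ 5, that prime is a deep prime of `n`. -/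
theorem mem_deep_of_factor {x n p : ℕ} (hn : n ≠ 0) (hdvd : x ∣ n) (hp : p ∈ x.primeFactors)
    (h5 : 5 ≤ x.factorization p) : p ∈ n.primeFactors.filter (fun p => 5 ≤ n.factorization p) := by
  have hx0 : x ≠ 0 := by rintro rfl; exact hn (zero_dvd_iff.mp hdvd)
  rw [Finset.mem_filter]
  refine ⟨Nat.primeFactors_mono hdvd hn hp, le_trans h5 ?_⟩
  exact (Nat.factorization_le_iff_dvd hx0 hn).mpr hdvd p

/-- PROVED: `CubeFreeTrivial` — m-free abc for m ≤ 3 is a triviality (exponent 1, constant √2). -/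
theorem cubeFreeTrivial_holds : CubeFreeTrivial := by
  intro a b c h h3
  have hne : a * b * c ≠ 0 := by
    obtain ⟨ha, hb, hsum, -⟩ := h
    have hc : 0 < c := by omega
    positivity
  calc c ^ 2 ≤ 2 * (a * b * c) := sq_le_two_mul_prod h
    _ ≤ 2 * (radical (a * b * c)) ^ 2 :=
        Nat.mul_le_mul_left 2 (le_radical_pow_of_factorization_le hne h3)
    _ = 2 * (rad a b c) ^ 2 := by rw [Literature.NumberTheory.DiophantineGeometry.rad_def]

/-- PROVED: `CalibrationZero` — cell 0 holds at exponent 2 with constant 2 (`c² ≤ 2·rad⁴`). -/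
theorem calibrationZero_holds : CalibrationZero := by
  intro a b c h h5
  have hne : a * b * c ≠ 0 := by
    obtain ⟨ha, hb, hsum, -⟩ := h
    have hc : 0 < c := by omega
    positivity
  calc c ^ 2 ≤ 2 * (a * b * c) := sq_le_two_mul_prod h
    _ ≤ 2 * (radical (a * b * c)) ^ 4 :=
        Nat.mul_le_mul_left 2 (le_radical_pow_of_factorization_le hne h5)
    _ = 2 * (rad a b c) ^ 4 := by rw [Literature.NumberTheory.DiophantineGeometry.rad_def]

/-- PROVED: `CalibrationOne` — cell 1 holds at exponent 4 with constant 2 (`c ≤ 2·rad⁴`). -/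
theorem calibrationOne_holds : CalibrationOne := by
  intro a b c h hK
  obtain ⟨ha, hb, hsum, hcop⟩ := h
  have hc : 0 < c := by omega
  have hne : a * b * c ≠ 0 := by positivity
  have hac : Nat.Coprime a c := by
    rw [← hsum, Nat.coprime_self_add_right]; exact hcop
  have hbc : Nat.Coprime b c := by
    rw [← hsum, add_comm, Nat.coprime_self_add_right]; exact hcop.symm
  have hda : a ∣ a * b * c := dvd_mul_of_dvd_left (dvd_mul_right a b) c
  have hdb : b ∣ a * b * c := dvd_mul_of_dvd_left (dvd_mul_left b a) c
  have hdc : c ∣ a * b * c := dvd_mul_left c (a * b)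
  rw [Literature.NumberTheory.DiophantineGeometry.rad_def]
  unfold omega5 at hK
  set D := (a * b * c).primeFactors.filter (fun p => 5 ≤ (a * b * c).factorization p) with hD
  by_cases hc5 : ∀ p ∈ c.primeFactors, c.factorization p ≤ 4
  · calc c ≤ (radical (a * b * c)) ^ 4 := le_radical_pow_four_of_dvd hne hdc hc5
      _ ≤ 2 * (radical (a * b * c)) ^ 4 := Nat.le_mul_of_pos_left _ (by norm_num)
  · push Not at hc5
    obtain ⟨q, hq, hq5⟩ := hc5
    have hqD : q ∈ D := mem_deep_of_factor hne hdc hq hq5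
    -- every member coprime to c is shallow: a deep prime of it would be q, dividing both it and c
    have shallow : ∀ x : ℕ, x ∣ a * b * c → Nat.Coprime x c →
        ∀ p ∈ x.primeFactors, x.factorization p ≤ 4 := by
      intro x hxd hxc p hp
      by_contra hlt
      push Not at hlt
      have hpD : p ∈ D := mem_deep_of_factor hne hxd hp hlt
      have hpq : p = q := Finset.card_le_one.mp hK p hpD q hqD
      have hpx : p ∣ x := Nat.dvd_of_mem_primeFactors hp
      have hpc : p ∣ c := hpq ▸ Nat.dvd_of_mem_primeFactors hq
      have h1 : p = 1 := Nat.Coprime.eq_one_of_dvd (Nat.Coprime.coprime_dvd_left hpx hxc) hpc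
      exact (Nat.prime_of_mem_primeFactors hp).one_lt.ne' h1
    have hale : a ≤ (radical (a * b * c)) ^ 4 := le_radical_pow_four_of_dvd hne hda (shallow a hda hac)
    have hble : b ≤ (radical (a * b * c)) ^ 4 := le_radical_pow_four_of_dvd hne hdb (shallow b hdb hbc)
    omega

end CalibrationProofs

end Summit.ABC.ABC.Cruxes.DepthCountedABC.Ideator2
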